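import Summits.Parity.GeneralizedHardyLittlewood.Theorems.PrimeLevelFamEdgeMomentsBeyondDiagonalDiagShapeOfSeries
import HarnessLib

/-!
# Route `PrimeLevelFamEdge`, crux K_A `MomentsBeyondDiagonal` (stmt-Parity-20007), line «petersson_layers» v4, stub `stub_diag`:
# **`SubDiag` ⟸ PER-ORDER, `Q`-FREE asymptotics of the explicit line series** (census R4, the general-`Q` assembly layer)

The registered stub `stub_diag : SubDiag` quantifies over EVERY even-or-odd `Q`; after `…DiagShapeOfSeries` (p812418:
`SubDiag` ⟸ asymptotics of the explicit line series `Σ_{i,j ≤ deg Q} QᵢQⱼ ℓ^{−(i+j)} (1+(−1)^{i+j}) q̂ · S_{ij}(q, P, Δ')`) the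
`Q`-dependence is carried ONLY by the coefficients `QᵢQⱼ`: the order-`(i,j)` inner sum
`S_{ij}(q,P,Δ') = Σ_{m₁,m₂ ≤ M} x_{m₁}x_{m₂} Σ_{d₁∣m₁,d₂∣m₂} c (m₁m₂)^{−1/2} 𝔚_{ij}(A₁,A₂;K/q̂²)` does not see `Q`.
This file records the bookkeeping consequence, so that the remaining analytic work (census R3(ii)) is a COUNTABLE FAMILY OF
`Q`-FREE TARGETS, one per order `(i, j)` with `i + j` even (the odd orders are killed by the factor `1 + (−1)^{i+j}` for every `Q`):

* `hasShape_diagPart_of_orderAsymptotics` — if for every `(i,j)` with `i+j` even, every admissible `P` and every `Δ' ∈ (1, Δ]`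
  (`Δ ≤ 3/2`) one has `‖ℓ^{−(i+j)} q̂ S_{ij}(q,P,Δ') − 2ζ(2)² q̂/(Δ'²ℓ²)·τ_{ij}(Δ',P)‖ ≤ C q̂ ℓ⁻³` for `q ≥ q₀` with a level-free
  `τ_{ij}`, then `HasShape diagPart Δ t` with the level-free functional
  `t(Δ',P,Q) := Σ_{i,j ≤ deg Q} QᵢQⱼ(1+(−1)^{i+j}) τ_{ij}(Δ',P)` (finite sum of the per-order bounds, thresholds maximised);
* `subDiag_of_orderAsymptotics` — hence `SubDiag`.

(The order `(0,0)` target is the `Q = 1` theorem of the tree, `…DiagProfileOne.diagPart_profile_one_asymp`, with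
`τ₀₀ = secondMomentForm Δ' P 1 / 2`; that discharge is filed separately.) Def-free; helper `--supports stmt-Parity-20007`;
closes nothing; K_A, K_B and the Parity summit are NOT proved; nothing about Landau–Siegel zeros.

## References
* E. Kowalski, P. Michel, J. VanderKam, J. reine angew. Math. 526 (2000), (21)–(28) pp. 12–15 (the diagonal residues are
  computed order by order in the derivatives). [cite: KowalskiMichelVanderKam2000, (23)–(28) pp. 13–15 — derivation]
-/

noncomputable section

open scoped Real
open Complex MeasureTheory Polynomial
open Literature.NumberTheory.LFunctions

namespace Summit.Parity.GeneralizedHardyLittlewood.Theorems.MomentsBeyondDiagonal.DiagLines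

open Summit.Parity.GeneralizedHardyLittlewood.Theorems.PrimeLevelFamEdgeIdeaDeltas.PeterssonLayers
  (diagPart HasShape SubOf SubDiag)

/-! ## §1. Two bookkeeping lemmas -/

/-- `‖Σᵢ Σⱼ fᵢⱼ − Σᵢ Σⱼ gᵢⱼ‖ ≤ Σᵢ Σⱼ ‖fᵢⱼ − gᵢⱼ‖`. [folklore] -/
theorem norm_sum_sum_sub_sum_sum_le (s t : Finset ℕ) (f g : ℕ → ℕ → ℂ) :
    ‖∑ i ∈ s, ∑ j ∈ t, f i j - ∑ i ∈ s, ∑ j ∈ t, g i j‖ ≤ ∑ i ∈ s, ∑ j ∈ t, ‖f i j - g i j‖ := by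
  rw [← Finset.sum_sub_distrib]
  refine (norm_sum_le _ _).trans (Finset.sum_le_sum fun i _ ↦ ?_)
  rw [← Finset.sum_sub_distrib]
  exact norm_sum_le _ _

/-- **The order-`n = i+j` term of the line series against its main term.** If (for `n` even) the normalised inner sum
`ℓ^{−n} q̂ S(q)` is `2ζ(2)² q̂/(Δ'²ℓ²)·τ₀ + O(q̂ℓ⁻³)`, then the full summand `a b ℓ^{−n}(1+(−1)ⁿ) q̂ S(q)` is
`2ζ(2)² q̂/(Δ'²ℓ²)·(a b (1+(−1)ⁿ) τ₀) + O(q̂ℓ⁻³)`; for `n` odd both sides vanish and nothing is assumed.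
[cite: KowalskiMichelVanderKam2000, (23)–(28) pp. 13–15 — derivation] -/
theorem order_term_asymp (a b τ₀ Δ' : ℝ) (n : ℕ) (S : (q : ℕ) → [NeZero q] → ℂ)
    (h : Even n → ∃ C : ℝ, ∃ q₀ : ℕ, ∀ (q : ℕ) [NeZero q], q₀ ≤ q →
      ‖(((Real.log (KMV2000.qhat q))⁻¹ : ℝ) : ℂ) ^ n * (KMV2000.qhat q : ℂ) * S q -
          ((2 * riemannZeta 2 ^ 2 *
              ((KMV2000.qhat q / (Δ' ^ 2 * Real.log (KMV2000.qhat q) ^ 2) : ℝ) : ℂ)) * ((τ₀ : ℝ) : ℂ))‖ ≤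
        C * KMV2000.qhat q * (Real.log (KMV2000.qhat q))⁻¹ ^ 3) :
    ∃ C : ℝ, ∃ q₀ : ℕ, ∀ (q : ℕ) [NeZero q], q₀ ≤ q →
      ‖(a : ℂ) * (b : ℂ) * (((Real.log (KMV2000.qhat q))⁻¹ : ℝ) : ℂ) ^ n * (1 + (-1 : ℂ) ^ n) *
            (KMV2000.qhat q : ℂ) * S q -
          ((2 * riemannZeta 2 ^ 2 *
              ((KMV2000.qhat q / (Δ' ^ 2 * Real.log (KMV2000.qhat q) ^ 2) : ℝ) : ℂ)) *
            ((a : ℂ) * (b : ℂ) * (1 + (-1 : ℂ) ^ n) * ((τ₀ : ℝ) : ℂ)))‖ ≤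
        C * KMV2000.qhat q * (Real.log (KMV2000.qhat q))⁻¹ ^ 3 := by
  rcases Nat.even_or_odd n with hn | hn
  · obtain ⟨C, q₀, hC⟩ := h hn
    refine ⟨|a| * |b| * 2 * C, q₀, fun q _ hq ↦ ?_⟩
    have hq' := hC q hq
    have hE : (1 + (-1 : ℂ) ^ n) = 2 := by rw [hn.neg_one_pow]; norm_num
    rw [hE]
    have hfac : (a : ℂ) * (b : ℂ) * (((Real.log (KMV2000.qhat q))⁻¹ : ℝ) : ℂ) ^ n * 2 *
            (KMV2000.qhat q : ℂ) * S q -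
          ((2 * riemannZeta 2 ^ 2 *
              ((KMV2000.qhat q / (Δ' ^ 2 * Real.log (KMV2000.qhat q) ^ 2) : ℝ) : ℂ)) *
            ((a : ℂ) * (b : ℂ) * 2 * ((τ₀ : ℝ) : ℂ))) =
        ((a : ℂ) * (b : ℂ) * 2) *
          ((((Real.log (KMV2000.qhat q))⁻¹ : ℝ) : ℂ) ^ n * (KMV2000.qhat q : ℂ) * S q -
            ((2 * riemannZeta 2 ^ 2 *
              ((KMV2000.qhat q / (Δ' ^ 2 * Real.log (KMV2000.qhat q) ^ 2) : ℝ) : ℂ)) * ((τ₀ : ℝ) : ℂ))) := by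
      ring
    have hnorm : ‖(a : ℂ) * (b : ℂ) * 2‖ = |a| * |b| * 2 := by
      rw [norm_mul, norm_mul, Complex.norm_real, Complex.norm_real, Real.norm_eq_abs, Real.norm_eq_abs,
        Complex.norm_two]
    rw [hfac, norm_mul, hnorm]
    exact (mul_le_mul_of_nonneg_left hq' (by positivity)).trans_eq (by ring)
  · refine ⟨0, 0, fun q _ _ ↦ ?_⟩
    have hE : (1 + (-1 : ℂ) ^ n) = 0 := by rw [hn.neg_one_pow]; norm_num
    rw [hE]
    simp

/-! ## §2. `HasShape diagPart` and `SubDiag` from per-order asymptotics -/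

/-- **`HasShape diagPart` FROM PER-ORDER, `Q`-FREE ASYMPTOTICS** (census R4, general-`Q` assembly). Let `Δ ≤ 3/2` and let
`τ i j : ℝ → ℝ[X] → ℝ` be level-free functionals. Suppose that for every order `(i, j)` with `i + j` even, every admissible
`P` and every `Δ' ∈ (1, Δ]` there are `C, q₀` with, for all levels `q ≥ q₀` (`M = q̂^{Δ'}`, `ℓ = log q̂`, notation of
`…DiagLineSeries`),
`‖ℓ^{−(i+j)} q̂ Σ_{m₁,m₂ ≤ M} x_{m₁}x_{m₂} Σ_{d₁∣m₁,d₂∣m₂} c (m₁m₂)^{−1/2} 𝔚_{ij}(A₁,A₂;K/q̂²) − 2ζ(2)² q̂/(Δ'²ℓ²)·τ_{ij}(Δ',P)‖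
≤ C q̂ ℓ⁻³`. Then the diagonal part has the second-display shape on `(1, Δ]` with the level-free functional
`t(Δ',P,Q) = Σ_{i,j ≤ deg Q} QᵢQⱼ(1+(−1)^{i+j}) τ_{ij}(Δ',P)`.
[cite: KowalskiMichelVanderKam2000, (23)–(28) pp. 13–15 — derivation] -/
theorem hasShape_diagPart_of_orderAsymptotics {Δ : ℝ} (hΔ : Δ ≤ 3 / 2) (τ : ℕ → ℕ → ℝ → ℝ[X] → ℝ)
    (h : ∀ i j : ℕ, Even (i + j) → ∀ P : ℝ[X], KMV2000.Admissible P → ∀ Δ' : ℝ, 1 < Δ' → Δ' ≤ Δ →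
      ∃ C : ℝ, ∃ q₀ : ℕ, ∀ (q : ℕ) [NeZero q], q₀ ≤ q →
        ‖(((Real.log (KMV2000.qhat q))⁻¹ : ℝ) : ℂ) ^ (i + j) * (KMV2000.qhat q : ℂ) *
          ∑ m₁ ∈ Finset.Icc 1 ⌊KMV2000.qhat q ^ Δ'⌋₊, ∑ m₂ ∈ Finset.Icc 1 ⌊KMV2000.qhat q ^ Δ'⌋₊,
            (KMV2000.mollifierCoeff P (KMV2000.qhat q ^ Δ') m₁ : ℂ) *
              (KMV2000.mollifierCoeff P (KMV2000.qhat q ^ Δ') m₂ : ℂ) *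
            ∑ d₁ ∈ m₁.divisors, ∑ d₂ ∈ m₂.divisors,
              (((((m₁ / d₁).gcd (m₂ / d₂) : ℝ) * ((m₁ : ℝ) * m₂) ^ (-(1 / 2 : ℝ)) *
                (∫ u₁ in Set.Ioi (0 : ℝ),
                  (Real.log (KMV2000.qhat q / ((d₁ * (m₂ / d₂ / (m₁ / d₁).gcd (m₂ / d₂)) : ℕ) : ℝ)) + Real.log u₁) ^ i *
                  ∫ u₂ in Set.Ioi (((((m₁ / (m₁ / d₁).gcd (m₂ / d₂)) * (m₂ / (m₁ / d₁).gcd (m₂ / d₂)) : ℕ) : ℝ) /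
                      KMV2000.qhat q ^ 2) / u₁),
                    Real.exp (-(u₁ + u₂)) / (1 - Real.exp (-(u₁ + u₂))) ^ 2 *
                    (Real.log (KMV2000.qhat q / ((d₂ * (m₁ / d₁ / (m₁ / d₁).gcd (m₂ / d₂)) : ℕ) : ℝ)) + Real.log u₂) ^ j)) : ℝ) : ℂ) -
          ((2 * riemannZeta 2 ^ 2 *
              ((KMV2000.qhat q / (Δ' ^ 2 * Real.log (KMV2000.qhat q) ^ 2) : ℝ) : ℂ)) * ((τ i j Δ' P : ℝ) : ℂ))‖ ≤
          C * KMV2000.qhat q * (Real.log (KMV2000.qhat q))⁻¹ ^ 3) :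
    HasShape (fun q _ P Q Δ' ↦ diagPart q P Q Δ') Δ
      (fun Δ' P Q ↦ ∑ i ∈ Finset.range (Q.natDegree + 1), ∑ j ∈ Finset.range (Q.natDegree + 1),
        Q.coeff i * Q.coeff j * (1 + (-1 : ℝ) ^ (i + j)) * τ i j Δ' P) := by
  refine hasShape_diagPart_of_lineSeries hΔ _ ?_
  intro P Q hP _ Δ' h1 h2
  -- per-order bounds for the full summands (odd orders vanish identically)
  have hterm := fun i j : ℕ ↦ order_term_asymp (Q.coeff i) (Q.coeff j) (τ i j Δ' P) Δ' (i + j)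
    (fun q _ ↦ ∑ m₁ ∈ Finset.Icc 1 ⌊KMV2000.qhat q ^ Δ'⌋₊, ∑ m₂ ∈ Finset.Icc 1 ⌊KMV2000.qhat q ^ Δ'⌋₊,
            (KMV2000.mollifierCoeff P (KMV2000.qhat q ^ Δ') m₁ : ℂ) *
              (KMV2000.mollifierCoeff P (KMV2000.qhat q ^ Δ') m₂ : ℂ) *
            ∑ d₁ ∈ m₁.divisors, ∑ d₂ ∈ m₂.divisors,
              (((((m₁ / d₁).gcd (m₂ / d₂) : ℝ) * ((m₁ : ℝ) * m₂) ^ (-(1 / 2 : ℝ)) *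
                (∫ u₁ in Set.Ioi (0 : ℝ),
                  (Real.log (KMV2000.qhat q / ((d₁ * (m₂ / d₂ / (m₁ / d₁).gcd (m₂ / d₂)) : ℕ) : ℝ)) + Real.log u₁) ^ i *
                  ∫ u₂ in Set.Ioi (((((m₁ / (m₁ / d₁).gcd (m₂ / d₂)) * (m₂ / (m₁ / d₁).gcd (m₂ / d₂)) : ℕ) : ℝ) /
                      KMV2000.qhat q ^ 2) / u₁),
                    Real.exp (-(u₁ + u₂)) / (1 - Real.exp (-(u₁ + u₂))) ^ 2 *
                    (Real.log (KMV2000.qhat q / ((d₂ * (m₁ / d₁ / (m₁ / d₁).gcd (m₂ / d₂)) : ℕ) : ℝ)) + Real.log u₂) ^ j)) : ℝ) : ℂ))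
    (fun hij ↦ h i j hij P hP Δ' h1 h2)
  choose C q₀ hC using hterm
  refine ⟨∑ i ∈ Finset.range (Q.natDegree + 1), ∑ j ∈ Finset.range (Q.natDegree + 1), C i j,
    (Finset.range (Q.natDegree + 1) ×ˢ Finset.range (Q.natDegree + 1)).sup (fun p ↦ q₀ p.1 p.2),
    fun q _ hq ↦ ?_⟩
  -- the main term as a double sum
  have hmain : ((2 * riemannZeta 2 ^ 2 *
        ((KMV2000.qhat q / (Δ' ^ 2 * Real.log (KMV2000.qhat q) ^ 2) : ℝ) : ℂ)) *
      (((∑ i ∈ Finset.range (Q.natDegree + 1), ∑ j ∈ Finset.range (Q.natDegree + 1),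
        Q.coeff i * Q.coeff j * (1 + (-1 : ℝ) ^ (i + j)) * τ i j Δ' P : ℝ)) : ℂ)) =
      ∑ i ∈ Finset.range (Q.natDegree + 1), ∑ j ∈ Finset.range (Q.natDegree + 1),
        ((2 * riemannZeta 2 ^ 2 *
          ((KMV2000.qhat q / (Δ' ^ 2 * Real.log (KMV2000.qhat q) ^ 2) : ℝ) : ℂ)) *
          ((Q.coeff i : ℂ) * (Q.coeff j : ℂ) * (1 + (-1 : ℂ) ^ (i + j)) * ((τ i j Δ' P : ℝ) : ℂ))) := by
    rw [Complex.ofReal_sum, Finset.mul_sum]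
    refine Finset.sum_congr rfl fun i _ ↦ ?_
    rw [Complex.ofReal_sum, Finset.mul_sum]
    refine Finset.sum_congr rfl fun j _ ↦ ?_
    push_cast
    ring
  rw [hmain]
  refine (norm_sum_sum_sub_sum_sum_le _ _ _ _).trans ?_
  calc _ ≤ ∑ i ∈ Finset.range (Q.natDegree + 1), ∑ j ∈ Finset.range (Q.natDegree + 1),
          C i j * KMV2000.qhat q * (Real.log (KMV2000.qhat q))⁻¹ ^ 3 := by
        refine Finset.sum_le_sum fun i hi ↦ Finset.sum_le_sum fun j hj ↦ hC i j q ?_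
        have hle : q₀ i j ≤ (Finset.range (Q.natDegree + 1) ×ˢ Finset.range (Q.natDegree + 1)).sup
            (fun p ↦ q₀ p.1 p.2) :=
          Finset.le_sup (f := fun p : ℕ × ℕ ↦ q₀ p.1 p.2) (b := (i, j)) (Finset.mem_product.mpr ⟨hi, hj⟩)
        exact hle.trans hq
    _ = (∑ i ∈ Finset.range (Q.natDegree + 1), ∑ j ∈ Finset.range (Q.natDegree + 1), C i j) *
          KMV2000.qhat q * (Real.log (KMV2000.qhat q))⁻¹ ^ 3 := by
        rw [Finset.sum_mul, Finset.sum_mul]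
        refine Finset.sum_congr rfl fun i _ ↦ ?_
        rw [Finset.sum_mul, Finset.sum_mul]

/-- **`SubDiag` FROM PER-ORDER, `Q`-FREE ASYMPTOTICS** on some window `(1, Δ]`, `1 < Δ ≤ 3/2` (census R4, general-`Q`
assembly): the registered stub `stub_diag` follows from the countable family of `Q`-free targets of
`hasShape_diagPart_of_orderAsymptotics`, one per order `(i,j)` with `i + j` even.
[cite: KowalskiMichelVanderKam2000, (23)–(28) pp. 13–15 — derivation] -/
theorem subDiag_of_orderAsymptotics {Δ : ℝ} (hΔ1 : 1 < Δ) (hΔ : Δ ≤ 3 / 2) (τ : ℕ → ℕ → ℝ → ℝ[X] → ℝ)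
    (h : ∀ i j : ℕ, Even (i + j) → ∀ P : ℝ[X], KMV2000.Admissible P → ∀ Δ' : ℝ, 1 < Δ' → Δ' ≤ Δ →
      ∃ C : ℝ, ∃ q₀ : ℕ, ∀ (q : ℕ) [NeZero q], q₀ ≤ q →
        ‖(((Real.log (KMV2000.qhat q))⁻¹ : ℝ) : ℂ) ^ (i + j) * (KMV2000.qhat q : ℂ) *
          ∑ m₁ ∈ Finset.Icc 1 ⌊KMV2000.qhat q ^ Δ'⌋₊, ∑ m₂ ∈ Finset.Icc 1 ⌊KMV2000.qhat q ^ Δ'⌋₊,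
            (KMV2000.mollifierCoeff P (KMV2000.qhat q ^ Δ') m₁ : ℂ) *
              (KMV2000.mollifierCoeff P (KMV2000.qhat q ^ Δ') m₂ : ℂ) *
            ∑ d₁ ∈ m₁.divisors, ∑ d₂ ∈ m₂.divisors,
              (((((m₁ / d₁).gcd (m₂ / d₂) : ℝ) * ((m₁ : ℝ) * m₂) ^ (-(1 / 2 : ℝ)) *
                (∫ u₁ in Set.Ioi (0 : ℝ),
                  (Real.log (KMV2000.qhat q / ((d₁ * (m₂ / d₂ / (m₁ / d₁).gcd (m₂ / d₂)) : ℕ) : ℝ)) + Real.log u₁) ^ i *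
                  ∫ u₂ in Set.Ioi (((((m₁ / (m₁ / d₁).gcd (m₂ / d₂)) * (m₂ / (m₁ / d₁).gcd (m₂ / d₂)) : ℕ) : ℝ) /
                      KMV2000.qhat q ^ 2) / u₁),
                    Real.exp (-(u₁ + u₂)) / (1 - Real.exp (-(u₁ + u₂))) ^ 2 *
                    (Real.log (KMV2000.qhat q / ((d₂ * (m₁ / d₁ / (m₁ / d₁).gcd (m₂ / d₂)) : ℕ) : ℝ)) + Real.log u₂) ^ j)) : ℝ) : ℂ) -
          ((2 * riemannZeta 2 ^ 2 *
              ((KMV2000.qhat q / (Δ' ^ 2 * Real.log (KMV2000.qhat q) ^ 2) : ℝ) : ℂ)) * ((τ i j Δ' P : ℝ) : ℂ))‖ ≤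
          C * KMV2000.qhat q * (Real.log (KMV2000.qhat q))⁻¹ ^ 3) :
    SubDiag :=
  ⟨Δ, hΔ1, _, hasShape_diagPart_of_orderAsymptotics hΔ τ h⟩

end Summit.Parity.GeneralizedHardyLittlewood.Theorems.MomentsBeyondDiagonal.DiagLines

end
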